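/-
Copyright: b2b-lace packet (explicit-unit carver, gen 17).  [NoBLE17-I] §5.3.3: the general-cut skeleton of
the weighted repulsive bubble `(G_{m,z} ⊗_w H_z)(0)` = explicit first-path pieces `i = m, …, M`
(`WeightedBubbleExtraction`) + the tail at length `≥ M + 1` bounded by `(2dp)^{M+1} ℋ^{1,M+1}_p(0)`
(`WeightedBubbleTail`), joined in one statement.  Over the tree objects only; no cited fact.
-/
import Literature.Probability.FitznerVanDerHofstad2017.WeightedBubbleExtraction
import Literature.Probability.FitznerVanDerHofstad2017.WeightedBubbleTail
import HarnessLib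

/-!
# The weighted repulsive bubble at a general cut `M`: explicit pieces plus the `f₃` tail

[NoBLE17-I] = R. Fitzner, R. van der Hofstad, *Generalized approach to the non-backtracking lace expansion*,
PTRF 169 (2017) 1041–1119 (arXiv:1506.07969), §5.3.3 (p. 1099): the weighted repulsive bubble
`Σ_y ‖y‖₂² P_p({0 ←m→ y} ∘ {y ↔ 0})` (percolation reading, `G_z = τ_p`) is bounded by splitting off the
exact length `i ≤ M` of the first open path (the display with the cut `5/6`, here with a general `M`) and
bounding the remaining tail "using `f₃` by removing the added restrictions that the `⊗` convolution imposes and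
replacing it by a normal convolution … `a₆(y) ≤ (2d)⁶ D^{⋆6}(y)`" (last paragraph of §5.3.3).  The two halves
are the tree's `tsum_weighted_repBubble_le_extraction` (`WeightedBubbleExtraction`, [NoBLE17-I] (5.38)
iterated) and `tsum_sq_weighted_repBubbleTail_le_nobleH` (`WeightedBubbleTail`, BK + [FvdH17] (4.3)); this
module only joins them:

* `tsum_sq_weighted_repBubble_le_skeleton` — for all `m, M`, whenever the series defining `ℋ^{1,M+1}_p(0)`
  converges,
  `Σ_y ‖y‖₂² P_p({0 ←m→ y} ∘ {y ↔ 0})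
     ≤ Σ_{i=m}^{M} p^i Σ_{u ∈ SAW_i} ‖u(i)‖₂² P^{bonds(u)}_p(u(i) ↔ 0) + (2dp)^{M+1} ℋ^{1,M+1}_p(0)`
  (in `ℝ≥0∞`; `P^{B}_p(E)` = `probOff`, the event read off the bonds `B`);
* `tsum_sq_weighted_repBubble_le_skeleton_tau` — the same with the repulsion of the explicit pieces dropped,
  `P^{bonds(u)}_p(u(i) ↔ 0) ≤ τ_p(u(i))`.

At the printed cut `M = 5` the tail term is `(2dp)⁶ ℋ^{1,6}_p(0)`, the `(1,6,{0})` cell of the bootstrap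
function `f₃` ([FvdH17] (2.21)–(2.23)); the inequality `ℋ^{1,M+1}_p(0) ≤ c Γ₃` is the bootstrap hypothesis and
is not part of this module.  No named hypothesis other than the convergence binder; no `sorry`.

## References
* [NoBLE17-I] R. Fitzner, R. van der Hofstad, PTRF 169 (2017) 1041–1119; arXiv:1506.07969 — §5.3.1 (5.38),
  §5.3.3 (p. 1099).
* [FvdH17] R. Fitzner, R. van der Hofstad, Electron. J. Probab. 22 (2017) no. 43; arXiv:1506.07977v2 —
  §4.2 (4.3), (4.12), (4.18); §2.2 (2.21)–(2.23).
* G. Grimmett, Percolation, 2nd ed., Springer 1999 — §2.3 (2.17).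
-/

noncomputable section

namespace Literature.Probability.FitznerVanDerHofstad2017

open _root_.MeasureTheory Literature.Barriers.CriticalPhenomena Literature.Probability.Percolation
open Literature.Probability.LatticeModels
open Literature.Barriers.CriticalPhenomena.SpreadOutIsing (latticeConv convPow)
open scoped BigOperators ENNReal

variable {d : ℕ}

/-- **The general-cut skeleton of the weighted repulsive bubble.**  For all `m, M` and `p`, if the series
defining `ℋ^{1,M+1}_p(0)` converges:
`Σ_y ‖y‖₂² P_p({0 ←m→ y} ∘ {y ↔ 0}) ≤ Σ_{i ∈ [m,M]} p^i Σ_{u ∈ SAW_i} ‖u(i)‖₂² P^{bonds(u)}_p(u(i) ↔ 0)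
  + (2dp)^{M+1} ℋ^{1,M+1}_p(0)` — explicit first-path pieces ([NoBLE17-I] (5.38) iterated to the cut `M`, the
tree's `tsum_weighted_repBubble_le_extraction`) plus the tail (BK and `a_{M+1} ≤ (2d)^{M+1} D^{⋆(M+1)}`, the
tree's `tsum_sq_weighted_repBubbleTail_le_nobleH`).
[cite: FitznerVanDerHofstad2016NoBLE, §5.3.1 (5.38) and §5.3.3 (PTRF 169 (2017) pp. 1097, 1099)]
[cite: FitznerVanDerHofstad2017, §4.2 (4.3), (4.12); §2.2 (2.21)] -/
theorem tsum_sq_weighted_repBubble_le_skeleton (p : unitInterval) (m M : ℕ)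
    (hH : Summable fun y : Site d =>
      euclidNorm y ^ 2 * (tau d p 0 y * latticeConv (convPow (srwStep d) (M + 1)) (tau d p 0) y)) :
    ∑' y : Site d, ENNReal.ofReal (euclidNorm y ^ 2) *
        bondPercolation (zdGraph d) p (openConnGe m (0 : Site d) y □ openConn y 0) ≤
      (∑ i ∈ Finset.Icc m M, ENNReal.ofReal ((p : ℝ) ^ i) *
          ∑ u ∈ sawWords d i, ENNReal.ofReal (euclidNorm (wordPos u i) ^ 2) *
            probOff d p ↑(wordEdges u) (openConn (wordPos u i) 0)) +
        ENNReal.ofReal ((2 * d * (p : ℝ)) ^ (M + 1) * nobleH d 1 (M + 1) p 0) :=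
  (tsum_weighted_repBubble_le_extraction p (fun y => ENNReal.ofReal (euclidNorm y ^ 2)) m M).trans
    (add_le_add le_rfl (tsum_sq_weighted_repBubbleTail_le_nobleH p (M + 1) hH))

/-- **The skeleton with the repulsion of the explicit pieces dropped** (`P^{bonds(u)}_p(u(i) ↔ 0) ≤ τ_p(u(i))`,
the tree's `tsum_weighted_repBubble_le_extraction_tau`):
`Σ_y ‖y‖₂² P_p({0 ←m→ y} ∘ {y ↔ 0}) ≤ Σ_{i ∈ [m,M]} p^i Σ_{u ∈ SAW_i} ‖u(i)‖₂² τ_p(u(i)) + (2dp)^{M+1} ℋ^{1,M+1}_p(0)`.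
[cite: FitznerVanDerHofstad2016NoBLE, §5.3.1 (5.38) and §5.3.3 (PTRF 169 (2017) pp. 1097, 1099)]
[cite: FitznerVanDerHofstad2017, §4.2 (4.3), (4.12); §2.2 (2.21)] -/
theorem tsum_sq_weighted_repBubble_le_skeleton_tau (p : unitInterval) (m M : ℕ)
    (hH : Summable fun y : Site d =>
      euclidNorm y ^ 2 * (tau d p 0 y * latticeConv (convPow (srwStep d) (M + 1)) (tau d p 0) y)) :
    ∑' y : Site d, ENNReal.ofReal (euclidNorm y ^ 2) *
        bondPercolation (zdGraph d) p (openConnGe m (0 : Site d) y □ openConn y 0) ≤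
      (∑ i ∈ Finset.Icc m M, ENNReal.ofReal ((p : ℝ) ^ i) *
          ∑ u ∈ sawWords d i, ENNReal.ofReal (euclidNorm (wordPos u i) ^ 2) *
            ENNReal.ofReal (tau d p 0 (wordPos u i))) +
        ENNReal.ofReal ((2 * d * (p : ℝ)) ^ (M + 1) * nobleH d 1 (M + 1) p 0) :=
  (tsum_weighted_repBubble_le_extraction_tau p (fun y => ENNReal.ofReal (euclidNorm y ^ 2)) m M).trans
    (add_le_add le_rfl (tsum_sq_weighted_repBubbleTail_le_nobleH p (M + 1) hH))

end Literature.Probability.FitznerVanDerHofstad2017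

end
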